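import Literature.Probability.LatticeModels.FKInterfaceDrivingLocality
import HarnessLib

/-!
# FK interfaces: a sure step bound and the exploration-filtration adapters of the clock packaging

Topic `Literature/Probability/LatticeModels` (family `crit-ising`); theorems only, no definition
and no named fact. Lattice companion of `RandomPlanarGeometry/ObservableClockPassage.lean`
(`Loewner.exists_discreteMartingaleData_of_clock`), which packages the discrete observable
martingale data (D) of the identification of the critical FK-Ising interfaces
(Duminil-Copin–Smirnov, Clay Math. Proc. 15 (2012), Lemma 6.6 and proof of Prop. 6.7;
Chelkak–Duminil-Copin–Hongler–Kemppainen–Smirnov, C. R. Math. 352 (2014), §3) from, per scale: a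
discrete filtration `𝒢`, a sure step bound `M` after which everything is revealed, an ADAPTED
capacity clock `θ`, and a driving process `V` that is `𝒢_M`-measurable and LOCAL
(`{u ≤ θ_n}.indicator (V u)` is `𝒢_n`-measurable). For the exploration filtration of the FK
interface (`DiscreteDobrushin.explorationFiltration`, `FKExplorationDomainMarkov.lean`: `𝒢_n` is
generated by the first `n + 2` medial vertices of the interface, its atoms are the prefix events
`C_n(ω₀) = explorationCylinder hE ω₀ n`) these hypotheses reduce to statements about CLASS
FUNCTIONS of the atoms, which is how the tree's locality results are phrased
(`FKInterfaceDrivingLocality.lean`). This file proves the reductions: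

* `DiscreteDobrushin.exitTime_le_card_innerCorners` — **a sure bound on the number of
  exploration steps**: the corners visited before the exit are distinct (`cornerOrbit_ne`) and
  have inner faces, of which there are finitely many (`finite_innerCorners`), so
  `exitTime hE ω ≤ #{corners with inner face}` for EVERY configuration `ω`;
* `DiscreteDobrushin.length_medialExploration`, `DiscreteDobrushin.explorationPrefix_eq_self` —
  the interface has `exitTime + 1` vertices, so the prefix map `explorationPrefix E n` is the
  whole interface once `exitTime ≤ n + 1`;
* `DiscreteDobrushin.measurable_explorationFiltration_comp_medialExploration` — **everything is
  revealed after the last step**: every function of the interface is `𝒢_M`-measurable for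
  `M + 1 ≥ sup exitTime`, in particular for `M = #{corners with inner face}`
  (`measurable_explorationFiltration_comp_medialExploration_card`) — the clause `hVM` of the
  clock packaging for any driving process read off the interface;
* `DiscreteDobrushin.adapted_explorationFiltration_of_forall_mem`,
  `DiscreteDobrushin.adapted_explorationFiltration_prefix` — a clock which at step `n` is a
  class function of `C_n` (e.g. any functional of the prefix `explorationPrefix E n`, such as the
  half-plane capacity of the explored piece) is ADAPTED;
* `DiscreteDobrushin.measurable_explorationFiltration_indicator_of_forall_mem` — **locality in
  indicator form**: if `θ_n` is a class function of `C_n` and `V_u` agrees on `C_n(ω₀)` for all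
  `u ≤ θ_n(ω₀)` (the conclusion of
  `drivingFunction_fkInterfaceCurve_eqOn_of_mem_explorationCylinder` at the capacity time of the
  explored piece), then `{u ≤ θ_n}.indicator (V u)` is `𝒢_n`-measurable — the clause `hVloc`.

## References

* H. Duminil-Copin, S. Smirnov, *Conformal invariance of lattice models*, Clay Math. Proc. 15
  (2012) 213–276 (arXiv:1109.1549): §6.2, Lemma 6.6 (`ℱ_n = σ(γ[0, n])`) and proof of Prop. 6.7
  (p. 29: `τ_t`, `ℱ_{τ_t}`). [DuminilCopinSmirnov2012Clay]
* S. Smirnov, *Critical percolation in the plane*, C. R. Acad. Sci. Paris 333 (2001), §2 (the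
  exploration process terminates). [Smirnov2001]
-/

noncomputable section

open MeasureTheory Set
open scoped NNReal

namespace Literature.Probability.LatticeModels

namespace DiscreteDobrushin

variable {E : DiscreteDobrushin}

/-! ### A sure bound on the number of exploration steps -/

/-- **The exploration exits after at most `#{corners with inner face}` steps, surely.** The
corners `orb 0, …, orb (exitTime - 1)` of the exploration of any configuration are pairwise
distinct (`cornerOrbit_ne`: the turning rule is injective and never returns to the start corner
while inside) and all have inner faces (`isInnerFace_of_lt_exitTime`); there are finitely many
such corners (`finite_innerCorners`). [cite: Smirnov2001, §2] -/
theorem exitTime_le_card_innerCorners (hE : E.IsZdAdmissible) (ω : Percolation.BondConfig (Site 2)) :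
    exitTime hE ω ≤ (finite_innerCorners hE).toFinset.card := by
  classical
  set S := (finite_innerCorners hE).toFinset with hS
  set f : ℕ → Site 2 × Fin 4 := cornerOrbit (E.bcBondConfig ω) (startCorner hE) with hf
  have hmaps : ∀ i ∈ Finset.range (exitTime hE ω), f i ∈ S := by
    intro i hi
    rw [Finset.mem_range] at hi
    rw [hS, Set.Finite.mem_toFinset]
    exact isInnerFace_of_lt_exitTime hE ω hi
  have hinj : Set.InjOn f (Finset.range (exitTime hE ω) : Set ℕ) := by
    intro i hi j hj hij
    simp only [Finset.coe_range, Set.mem_Iio] at hi hj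
    by_contra hne
    rcases lt_or_gt_of_ne hne with h | h
    · exact cornerOrbit_ne hE (isStartCorner_startCorner hE) h
        (fun k hk ↦ isInnerFace_of_lt_exitTime hE ω (hk.trans hj)) hij
    · exact cornerOrbit_ne hE (isStartCorner_startCorner hE) h
        (fun k hk ↦ isInnerFace_of_lt_exitTime hE ω (hk.trans hi)) hij.symm
  have := Finset.card_le_card_of_injOn f hmaps hinj
  rwa [Finset.card_range] at this

/-! ### After the last step the prefix is the whole interface -/

/-- The FK interface has `exitTime + 1` medial vertices. [cite: Smirnov2001, §2] -/
theorem length_medialExploration (hE : E.IsZdAdmissible) (ω : Percolation.BondConfig (Site 2)) :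
    (medialExploration E ω).length = exitTime hE ω + 1 := by
  rw [medialExploration_eq_explorationList hE ω, length_explorationList]

/-- Once `exitTime ω ≤ n + 1`, the prefix `explorationPrefix E n ω` (the first `n + 2` vertices)
is the whole interface. [cite: DuminilCopinSmirnov2012Clay, §6.2, Lemma 6.6] -/
theorem explorationPrefix_eq_self (hE : E.IsZdAdmissible) {ω : Percolation.BondConfig (Site 2)}
    {n : ℕ} (hn : exitTime hE ω ≤ n + 1) :
    explorationPrefix E n ω = medialExploration E ω := by
  unfold explorationPrefix
  apply List.take_of_length_le
  rw [length_medialExploration hE]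
  omega

/-- **Everything is revealed after the last step**: if `exitTime ≤ M + 1` surely, every function
of the interface is `𝒢_M`-measurable for the exploration filtration (on an atom `C_M(ω₀)` the
prefixes of length `M + 2`, i.e. the whole interfaces, agree). The clause `hVM` of
`Loewner.exists_discreteMartingaleData_of_clock` for any driving process read off the interface.
[cite: DuminilCopinSmirnov2012Clay, §6.2, Lemma 6.6] -/
theorem measurable_explorationFiltration_comp_medialExploration {hE : E.IsZdAdmissible}
    {β : Type*} [MeasurableSpace β] (g : List MedialVertex → β) {M : ℕ}
    (hM : ∀ ω, exitTime hE ω ≤ M + 1) :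
    Measurable[explorationFiltration hE M] (fun ω ↦ g (medialExploration E ω)) := by
  refine measurable_explorationFiltration_of_forall_mem fun ω₀ ω hω ↦ ?_
  have h := explorationPrefix_eq_of_mem_explorationCylinder hω
  rw [explorationPrefix_eq_self hE (hM ω), explorationPrefix_eq_self hE (hM ω₀)] at h
  rw [h]

/-- `measurable_explorationFiltration_comp_medialExploration` with the sure step bound
`M = #{corners with inner face}` (`exitTime_le_card_innerCorners`). [cite: Smirnov2001, §2] -/
theorem measurable_explorationFiltration_comp_medialExploration_card {hE : E.IsZdAdmissible}
    {β : Type*} [MeasurableSpace β] (g : List MedialVertex → β) :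
    Measurable[explorationFiltration hE (finite_innerCorners hE).toFinset.card]
      (fun ω ↦ g (medialExploration E ω)) :=
  measurable_explorationFiltration_comp_medialExploration g fun ω ↦
    (exitTime_le_card_innerCorners hE ω).trans (Nat.le_succ _)

/-! ### Adapted clocks -/

/-- **A clock that is a class function of the atoms at every step is adapted** to the
exploration filtration. [cite: DuminilCopinSmirnov2012Clay, Prop. 6.7 (proof, p. 29: `τ_t`)] -/
theorem adapted_explorationFiltration_of_forall_mem {hE : E.IsZdAdmissible} {β : Type*}
    [MeasurableSpace β] {θ : ℕ → Percolation.BondConfig (Site 2) → β}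
    (hθ : ∀ n ω₀ ω, ω ∈ explorationCylinder hE ω₀ n → θ n ω = θ n ω₀) :
    Adapted (explorationFiltration hE) θ := fun n ↦
  measurable_explorationFiltration_of_forall_mem (hθ n)

/-- **A clock read off the prefix is adapted**: for any functionals `g n` of the first `n + 2`
vertices, `(n, ω) ↦ g n (explorationPrefix E n ω)` is adapted to the exploration filtration (the
prefix is constant on atoms). In the application `g n` is the half-plane capacity of the image of
the prefix polyline. [cite: DuminilCopinSmirnov2012Clay, Prop. 6.7 (proof, p. 29: `τ_t`)] -/
theorem adapted_explorationFiltration_prefix {hE : E.IsZdAdmissible} {β : Type*}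
    [MeasurableSpace β] (g : ℕ → List MedialVertex → β) :
    Adapted (explorationFiltration hE) (fun n ω ↦ g n (explorationPrefix E n ω)) :=
  adapted_explorationFiltration_of_forall_mem fun n ω₀ ω hω ↦ by
    simp only [explorationPrefix_eq_of_mem_explorationCylinder hω]

/-! ### Locality in indicator form -/

/-- **Locality of the driving process, indicator form.** If the clock `θ_n` is a class function
of the atoms `C_n` and the value `V_u` agrees on `C_n(ω₀)` for every `u ≤ θ_n(ω₀)` (for the
capacity clock and the Loewner transform of the interface this is
`drivingFunction_fkInterfaceCurve_eqOn_of_mem_explorationCylinder`), then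
`{u ≤ θ_n}.indicator (V u)` is `𝒢_n`-measurable — the clause `hVloc` of
`Loewner.exists_discreteMartingaleData_of_clock`.
[cite: DuminilCopinSmirnov2012Clay, Prop. 6.7 (proof, p. 29: `ℱ_{τ_t}`)] -/
theorem measurable_explorationFiltration_indicator_of_forall_mem {hE : E.IsZdAdmissible}
    {θ : ℕ → Percolation.BondConfig (Site 2) → ℝ≥0} {V : ℝ≥0 → Percolation.BondConfig (Site 2) → ℝ}
    {n : ℕ} (hθ : ∀ ω₀ ω, ω ∈ explorationCylinder hE ω₀ n → θ n ω = θ n ω₀)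
    (hV : ∀ ω₀ ω, ω ∈ explorationCylinder hE ω₀ n → ∀ u, u ≤ θ n ω₀ → V u ω = V u ω₀) (u : ℝ≥0) :
    Measurable[explorationFiltration hE n] ({ω | u ≤ θ n ω}.indicator (V u)) := by
  refine measurable_explorationFiltration_of_forall_mem fun ω₀ ω hω ↦ ?_
  by_cases hu : u ≤ θ n ω₀
  · rw [indicator_of_mem (show ω ∈ {ω | u ≤ θ n ω} by rw [mem_setOf_eq, hθ ω₀ ω hω]; exact hu),
      indicator_of_mem (show ω₀ ∈ {ω | u ≤ θ n ω} from hu)]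
    exact hV ω₀ ω hω u hu
  · rw [indicator_of_notMem (show ω ∉ {ω | u ≤ θ n ω} by rw [mem_setOf_eq, hθ ω₀ ω hω]; exact hu),
      indicator_of_notMem (show ω₀ ∉ {ω | u ≤ θ n ω} from hu)]

end DiscreteDobrushin

end Literature.Probability.LatticeModels
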